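import Literature.AnabelianGeometry.AbsoluteAnabelian.AbsTopIII.EquivariantUnitAutomorphisms
import HarnessLib

/-!
# [AbsTopIII] Prop 3.3 (ii) `TCG` / [IUTchII] Rmk 1.11.1 (i)(b) at the model, II: exponents,
# uniqueness, and the automorphism `x ↦ x^a` for `a ∈ Ẑ^×`

Proof-only companion (theorems only, no new definitions), continuing
`EquivariantUnitAutomorphisms.lean` (S. Mochizuki, *Topics in Absolute Anabelian Geometry III*,
Prop. 3.3 (ii) p. 74; *Inter-universal Teichmüller Theory II*, Rmk. 1.11.1 (i)(b) p. 50; kurims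
manuscripts, lit keys `paper:url-5493eb38cbb7`, `paper:url-5036b4059555`).

* `MLFClosure.equivariant_unitMulEquiv_exponents` — every multiplicative automorphism of `𝒪_k̄^×`
  acts on the roots of unity through a compatible UNIT exponent system `a` (`a n ≡ a m (mod m)` for
  `m ∣ n`, `a n` prime to `n`);
* `MLFClosure.equivariant_unitMulEquiv_eq_of_rootsOfUnity` — two `Gal(k̄/k)`-equivariant automorphisms
  with the same action on the roots of unity coincide (abc-iut-L6-t21's rigidity engine);
* `MLFClosure.exists_equivariant_unitMulEquiv_of_compatible` — for a compatible unit system `a` the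
  equivariant map `x ↦ x^a` of `EquivariantUnitAutomorphisms.lean` is an AUTOMORPHISM (inverse
  `x ↦ x^b`, `a n b n ≡ 1`).

Together with the existence theorem: the `Gal(k̄/k)`-equivariant multiplicative automorphisms of
`𝒪_k̄^×` are EXACTLY the `Ẑ^×`-powers — [IUTchII] Rmk. 1.11.1 (i)(b) "the [`G`-linear] automorphisms …
determined by the natural action of `Ẑ^×`", the `Ẑ^×`-torsor half of [AbsTopIII] Prop. 3.3 (ii) for
`TCG` at the model.  (Existence of an isomorphism of pairs over a given `Π ⥲ Π*` = local class field
theory, not addressed.)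

HONEST FRAMING: OUR kernel check of classical statements quoted by refereed papers; nothing here
bears on [IUTchIII] Cor. 3.12.
-/

noncomputable section

namespace Literature.AnabelianGeometry.AbsoluteAnabelian

open _root_.ValuativeRel
open scoped IntermediateField

universe u

variable (C : MLFClosure.{u})

/-! ### The converse: exponents of an equivariant automorphism -/

/-- **Exponents.**  Every multiplicative automorphism `β` of `𝒪_k̄^×` acts on the roots of unity through
a compatible UNIT exponent system: there is `a : ℕ → ℕ`, `a n ≡ a m (mod m)` for `m ∣ n`, `a n` prime
to `n`, with `β ζ = ζ^{a m}` for every `m`-th root of unity (`μ_m` is cyclic, generated by a primitive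
root, and `β` preserves orders).  (Equivariance is not needed for this direction.)
[cite: MochizukiAbsTopIII2015, Proposition 3.3 (ii) p.74] -/
theorem MLFClosure.equivariant_unitMulEquiv_exponents
    (β : unitSubmonoid C.k C.K ≃* unitSubmonoid C.k C.K) :
    ∃ a : ℕ → ℕ, (∀ m n : ℕ, 0 < m → 0 < n → m ∣ n → a n ≡ a m [MOD m]) ∧
      (∀ n, 0 < n → (a n).Coprime n) ∧
      ∀ (x : unitSubmonoid C.k C.K) (m : ℕ), 0 < m → (x : C.K) ^ m = 1 →
        ((β x : unitSubmonoid C.k C.K) : C.K) = (x : C.K) ^ a m := by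
  classical
  have hβpow : ∀ (x : unitSubmonoid C.k C.K) (i : ℕ),
      ((β (x ^ i) : unitSubmonoid C.k C.K) : C.K) = ((β x : unitSubmonoid C.k C.K) : C.K) ^ i := by
    intro x i; rw [map_pow, SubmonoidClass.coe_pow]
  -- a primitive `n`-th root of unity `ζ n ∈ 𝒪_k̄^×` and the exponent of `β` on it
  have hprim : ∀ n : ℕ, 0 < n → ∃ z : unitSubmonoid C.k C.K, IsPrimitiveRoot (z : C.K) n ∧
      ∃ e : ℕ, ((β z : unitSubmonoid C.k C.K) : C.K) = (z : C.K) ^ e := by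
    intro n hn
    haveI : NeZero n := ⟨hn.ne'⟩
    obtain ⟨ζ, hζ⟩ := C.exists_isPrimitiveRoot n hn
    set z : unitSubmonoid C.k C.K := ⟨ζ, C.rootOfUnity_mem_unitSubmonoid hn hζ.pow_eq_one⟩
    have hzn : ((β z : unitSubmonoid C.k C.K) : C.K) ^ n = 1 := by
      rw [← hβpow, show z ^ n = 1 from Subtype.ext (by
        rw [SubmonoidClass.coe_pow]; exact hζ.pow_eq_one), map_one]; rfl
    obtain ⟨e, -, he⟩ := hζ.eq_pow_of_pow_eq_one hzn
    exact ⟨z, hζ, e, he.symm⟩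
  choose z hz e he using hprim
  -- the exponent system (value at `0` irrelevant)
  refine ⟨fun n => if hn : 0 < n then e n hn else 0, ?_, ?_, ?_⟩
  · -- compatibility
    intro m n hm hn hmn
    simp only [hm, hn, dif_pos]
    -- `β (ζ_m) = ζ_m ^ e m` and also `= ζ_m ^ e n` since `ζ_m ∈ μ_n`
    haveI : NeZero n := ⟨hn.ne'⟩
    have hzmm : ((z m hm : unitSubmonoid C.k C.K) : C.K) ^ m = 1 := (hz m hm).pow_eq_one
    have hzm_n : ((z m hm : unitSubmonoid C.k C.K) : C.K) ^ n = 1 := by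
      obtain ⟨c, rfl⟩ := hmn; rw [pow_mul, hzmm, one_pow]
    obtain ⟨i, -, hi⟩ := (hz n hn).eq_pow_of_pow_eq_one hzm_n
    have hzeq : z m hm = (z n hn) ^ i := Subtype.ext (by rw [SubmonoidClass.coe_pow, hi])
    have h1 : ((β (z m hm) : unitSubmonoid C.k C.K) : C.K) = (z m hm : C.K) ^ e n hn := by
      rw [hzeq, hβpow, he n hn, SubmonoidClass.coe_pow, ← pow_mul, ← pow_mul, mul_comm]
    rw [he m hm] at h1
    -- `ζ_m ^ e m = ζ_m ^ e n`: reduce the exponents mod `m` and use injectivity on `μ_m`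
    have h2 : ((z m hm : unitSubmonoid C.k C.K) : C.K) ^ (e m hm % m) =
        ((z m hm : unitSubmonoid C.k C.K) : C.K) ^ (e n hn % m) := by
      rw [C.pow_eq_pow_of_modEq hzmm (Nat.mod_modEq _ m), C.pow_eq_pow_of_modEq hzmm (Nat.mod_modEq _ m)]
      exact h1
    exact ((hz m hm).pow_inj (Nat.mod_lt _ hm) (Nat.mod_lt _ hm) h2).symm
  · -- units
    intro n hn
    simp only [hn, dif_pos]
    haveI : NeZero n := ⟨hn.ne'⟩
    -- `β` maps the primitive root `ζ_n` to a primitive root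
    have hzM : IsPrimitiveRoot (z n hn) n :=
      (IsPrimitiveRoot.map_iff_of_injective (f := (unitSubmonoid C.k C.K).subtype)
        Subtype.val_injective).mp (hz n hn)
    have hβz : IsPrimitiveRoot (β (z n hn)) n :=
      (IsPrimitiveRoot.map_iff_of_injective (f := β.toMonoidHom) β.injective).mpr hzM
    have hβz' : IsPrimitiveRoot (((β (z n hn) : unitSubmonoid C.k C.K)) : C.K) n :=
      (IsPrimitiveRoot.map_iff_of_injective (f := (unitSubmonoid C.k C.K).subtype)
        Subtype.val_injective).mpr hβz
    rw [he n hn] at hβz'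
    exact ((hz n hn).pow_iff_coprime hn (e n hn)).mp hβz'
  · -- the formula on all roots of unity
    intro x m hm hxm
    simp only [hm, dif_pos]
    haveI : NeZero m := ⟨hm.ne'⟩
    obtain ⟨i, -, hi⟩ := (hz m hm).eq_pow_of_pow_eq_one hxm
    have hxeq : x = (z m hm) ^ i := Subtype.ext (by rw [SubmonoidClass.coe_pow, hi])
    rw [hxeq, hβpow, he m hm, SubmonoidClass.coe_pow, ← pow_mul, ← pow_mul, mul_comm]

/-! ### Uniqueness and the automorphism for a unit system -/

/-- **Uniqueness.**  Two `Gal(k̄/k)`-equivariant multiplicative automorphisms of `𝒪_k̄^×` that agree on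
all roots of unity coincide (abc-iut-L6-t21's Kummer-class rigidity applied to `β₁⁻¹ ∘ β₂`).
[cite: MochizukiAbsTopIII2015, Proposition 3.3 (ii) p.74] -/
theorem MLFClosure.equivariant_unitMulEquiv_eq_of_rootsOfUnity
    (β₁ β₂ : unitSubmonoid C.k C.K ≃* unitSubmonoid C.k C.K)
    (h₁ : ∀ (σ : C.K ≃ₐ[C.k] C.K) (x y : unitSubmonoid C.k C.K), (y : C.K) = σ x →
      ((β₁ y : unitSubmonoid C.k C.K) : C.K) = σ ((β₁ x : unitSubmonoid C.k C.K) : C.K))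
    (h₂ : ∀ (σ : C.K ≃ₐ[C.k] C.K) (x y : unitSubmonoid C.k C.K), (y : C.K) = σ x →
      ((β₂ y : unitSubmonoid C.k C.K) : C.K) = σ ((β₂ x : unitSubmonoid C.k C.K) : C.K))
    (hμ : ∀ (x : unitSubmonoid C.k C.K) (m : ℕ), 0 < m → (x : C.K) ^ m = 1 → β₁ x = β₂ x) :
    β₁ = β₂ := by
  have hM : ∀ (σ : C.K ≃ₐ[C.k] C.K) (x : C.K), x ∈ unitSubmonoid C.k C.K → σ x ∈ unitSubmonoid C.k C.K :=
    fun σ x hx => smul_mem_unitSubmonoid σ hx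
  have hroot : ∀ x ∈ unitSubmonoid C.k C.K, ∀ n : ℕ, 0 < n → ∃ y ∈ unitSubmonoid C.k C.K, y ^ n = x :=
    fun x hx n hn => C.exists_unit_nthRoot hx hn
  have hμM : ∀ (ζ : C.K) (n : ℕ), 0 < n → ζ ^ n = 1 → ζ ∈ unitSubmonoid C.k C.K :=
    fun ζ n hn hζ => C.rootOfUnity_mem_unitSubmonoid hn hζ
  have h0 : (0 : C.K) ∉ unitSubmonoid C.k C.K := fun h => C.ne_zero_of_mem_unitSubmonoid h rfl
  set γ : unitSubmonoid C.k C.K →* unitSubmonoid C.k C.K := (β₂.trans β₁.symm).toMonoidHom with hγ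
  have hγapp : ∀ x, γ x = β₁.symm (β₂ x) := fun x => rfl
  -- `β₁.symm` is equivariant
  have h₁' : ∀ (σ : C.K ≃ₐ[C.k] C.K) (x y : unitSubmonoid C.k C.K), (y : C.K) = σ x →
      ((β₁.symm y : unitSubmonoid C.k C.K) : C.K) = σ ((β₁.symm x : unitSubmonoid C.k C.K) : C.K) := by
    intro σ x y hyx
    have h := h₁ σ (β₁.symm x) ⟨σ ((β₁.symm x : unitSubmonoid C.k C.K) : C.K), hM σ _ (β₁.symm x).2⟩ rfl
    rw [MulEquiv.apply_symm_apply] at h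
    -- h : ↑(β₁ ⟨σ ↑(β₁.symm x), _⟩) = σ ↑x
    have hy : y = β₁ ⟨σ ((β₁.symm x : unitSubmonoid C.k C.K) : C.K), hM σ _ (β₁.symm x).2⟩ :=
      Subtype.ext (by rw [hyx, h])
    rw [hy, MulEquiv.symm_apply_apply]
  have hγσ : ∀ (σ : C.K ≃ₐ[C.k] C.K) (x : unitSubmonoid C.k C.K),
      ((γ ⟨σ x, hM σ x x.2⟩ : unitSubmonoid C.k C.K) : C.K) = σ ((γ x : unitSubmonoid C.k C.K) : C.K) := by
    intro σ x
    rw [hγapp, hγapp]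
    exact h₁' σ (β₂ x) (β₂ ⟨σ x, hM σ x x.2⟩) (h₂ σ x ⟨σ x, hM σ x x.2⟩ rfl)
  have hγμ : ∀ (x : unitSubmonoid C.k C.K) (n : ℕ), 0 < n → (x : C.K) ^ n = 1 → γ x = x := by
    intro x n hn hxn
    rw [hγapp, ← hμ x n hn hxn, MulEquiv.symm_apply_apply]
  have hγid := C.submonoid_equivariant_eq_self (unitSubmonoid C.k C.K) hM hroot hμM h0 γ hγσ hγμ
  apply MulEquiv.ext
  intro x
  have := hγid x
  rw [hγapp] at this
  -- β₁.symm (β₂ x) = x ⇒ β₂ x = β₁ x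
  have h := congrArg β₁ this
  rw [MulEquiv.apply_symm_apply] at h
  exact h.symm

/-- **The automorphism `x ↦ x^a` for a unit `a ∈ Ẑ^×`.**  For a compatible exponent system `a` with
`a n` prime to `n` for all `n ≥ 1` there is a `Gal(k̄/k)`-equivariant multiplicative AUTOMORPHISM `β`
of `𝒪_k̄^×` with `β ζ = ζ^{a m}` on `μ_m` (and `β x ∈ x^{a n} · (k⟮x⟯^×)^n`); by
`equivariant_unitMulEquiv_eq_of_rootsOfUnity` it is unique, and by
`equivariant_unitMulEquiv_exponents` every equivariant automorphism is of this form — [IUTchII]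
Rmk. 1.11.1 (i)(b): the automorphisms of `G_k ↷ 𝒪_k̄^×` over the identity of `G_k` "are given by the
natural action of `Ẑ^×`"; [AbsTopIII] Prop. 3.3 (ii) `TCG`.  The inverse is `x ↦ x^b` for the
inverse system `b` (`a n · b n ≡ 1 (mod n)`); `β_b ∘ β_a = id` by the rigidity engine.
[cite: MochizukiAbsTopIII2015, Proposition 3.3 (ii) p.74] -/
theorem MLFClosure.exists_equivariant_unitMulEquiv_of_compatible (a : ℕ → ℕ)
    (ha : ∀ m n : ℕ, 0 < m → 0 < n → m ∣ n → a n ≡ a m [MOD m]) (hcop : ∀ n, 0 < n → (a n).Coprime n) :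
    ∃ β : unitSubmonoid C.k C.K ≃* unitSubmonoid C.k C.K,
      (∀ (σ : C.K ≃ₐ[C.k] C.K) (x y : unitSubmonoid C.k C.K), (y : C.K) = σ x →
        ((β y : unitSubmonoid C.k C.K) : C.K) = σ ((β x : unitSubmonoid C.k C.K) : C.K)) ∧
      (∀ (x : unitSubmonoid C.k C.K) (m : ℕ), 0 < m → (x : C.K) ^ m = 1 →
        ((β x : unitSubmonoid C.k C.K) : C.K) = (x : C.K) ^ a m) ∧
      (∀ (x : unitSubmonoid C.k C.K) (n : ℕ), 0 < n → ∃ w ∈ C.k⟮(x : C.K)⟯, w ≠ 0 ∧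
        ((β x : unitSubmonoid C.k C.K) : C.K) = (x : C.K) ^ a n * w ^ n) := by
  classical
  -- the inverse system `b`
  have hb : ∀ n : ℕ, ∃ b : ℕ, 0 < n → a n * b ≡ 1 [MOD n] := by
    intro n
    rcases Nat.lt_or_ge 1 n with hn | hn
    · obtain ⟨b, -, hb⟩ := Nat.exists_mul_mod_eq_one_of_coprime (hcop n (by omega)) hn
      exact ⟨b, fun _ => by rw [Nat.ModEq, hb, Nat.one_mod_eq_one.mpr hn.ne']⟩
    · refine ⟨0, fun hn0 => ?_⟩
      obtain rfl : n = 1 := le_antisymm hn hn0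
      exact Nat.modEq_one
  choose b hb using hb
  have hbcompat : ∀ m n : ℕ, 0 < m → 0 < n → m ∣ n → b n ≡ b m [MOD m] := by
    intro m n hm hn hmn
    have h1 : a m * b n ≡ 1 [MOD m] :=
      ((ha m n hm hn hmn).mul_right (b n)).symm.trans (Nat.ModEq.of_dvd hmn (hb n hn))
    have h2 : a m * b m ≡ 1 [MOD m] := hb m hm
    exact Nat.ModEq.cancel_left_of_coprime ((hcop m hm).symm ▸ rfl : m.gcd (a m) = 1)
      (h1.trans h2.symm)
  obtain ⟨β, hβσ, hβμ, hβw⟩ := C.exists_equivariant_unitHom_of_compatible a ha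
  obtain ⟨β', hβ'σ, hβ'μ, -⟩ := C.exists_equivariant_unitHom_of_compatible b hbcompat
  -- `β' ∘ β = id` and `β ∘ β' = id` by rigidity
  have hM : ∀ (σ : C.K ≃ₐ[C.k] C.K) (x : C.K), x ∈ unitSubmonoid C.k C.K → σ x ∈ unitSubmonoid C.k C.K :=
    fun σ x hx => smul_mem_unitSubmonoid σ hx
  have hroot : ∀ x ∈ unitSubmonoid C.k C.K, ∀ n : ℕ, 0 < n → ∃ y ∈ unitSubmonoid C.k C.K, y ^ n = x :=
    fun x hx n hn => C.exists_unit_nthRoot hx hn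
  have hμM : ∀ (ζ : C.K) (n : ℕ), 0 < n → ζ ^ n = 1 → ζ ∈ unitSubmonoid C.k C.K :=
    fun ζ n hn hζ => C.rootOfUnity_mem_unitSubmonoid hn hζ
  have h0 : (0 : C.K) ∉ unitSubmonoid C.k C.K := fun h => C.ne_zero_of_mem_unitSubmonoid h rfl
  -- composites of two such maps with exponent systems `c`, `d`, `c m · d m ≡ 1`, are the identity
  have hcomp : ∀ (f g : unitSubmonoid C.k C.K →* unitSubmonoid C.k C.K) (c d : ℕ → ℕ),
      (∀ (σ : C.K ≃ₐ[C.k] C.K) (x y : unitSubmonoid C.k C.K), (y : C.K) = σ x →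
        ((f y : unitSubmonoid C.k C.K) : C.K) = σ ((f x : unitSubmonoid C.k C.K) : C.K)) →
      (∀ (σ : C.K ≃ₐ[C.k] C.K) (x y : unitSubmonoid C.k C.K), (y : C.K) = σ x →
        ((g y : unitSubmonoid C.k C.K) : C.K) = σ ((g x : unitSubmonoid C.k C.K) : C.K)) →
      (∀ (x : unitSubmonoid C.k C.K) (m : ℕ), 0 < m → (x : C.K) ^ m = 1 →
        ((f x : unitSubmonoid C.k C.K) : C.K) = (x : C.K) ^ c m) →
      (∀ (x : unitSubmonoid C.k C.K) (m : ℕ), 0 < m → (x : C.K) ^ m = 1 →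
        ((g x : unitSubmonoid C.k C.K) : C.K) = (x : C.K) ^ d m) →
      (∀ m, 0 < m → c m * d m ≡ 1 [MOD m]) →
      g.comp f = MonoidHom.id _ := by
    intro f g c d hfσ hgσ hfμ hgμ hcd
    have hγσ : ∀ (σ : C.K ≃ₐ[C.k] C.K) (x : unitSubmonoid C.k C.K),
        (((g.comp f) ⟨σ x, hM σ x x.2⟩ : unitSubmonoid C.k C.K) : C.K) =
          σ (((g.comp f) x : unitSubmonoid C.k C.K) : C.K) := by
      intro σ x
      rw [MonoidHom.comp_apply, MonoidHom.comp_apply]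
      exact hgσ σ (f x) (f ⟨σ x, hM σ x x.2⟩) (hfσ σ x ⟨σ x, hM σ x x.2⟩ rfl)
    have hγμ : ∀ (x : unitSubmonoid C.k C.K) (n : ℕ), 0 < n → (x : C.K) ^ n = 1 → (g.comp f) x = x := by
      intro x n hn hxn
      apply Subtype.ext
      have hfx : ((f x : unitSubmonoid C.k C.K) : C.K) ^ n = 1 := by
        rw [hfμ x n hn hxn, ← pow_mul, mul_comm, pow_mul, hxn, one_pow]
      rw [MonoidHom.comp_apply, hgμ (f x) n hn hfx, hfμ x n hn hxn, ← pow_mul,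
        C.pow_eq_pow_of_modEq hxn (hcd n hn), pow_one]
    have hγid := C.submonoid_equivariant_eq_self (unitSubmonoid C.k C.K) hM hroot hμM h0 (g.comp f) hγσ hγμ
    exact MonoidHom.ext hγid
  have h1 : β'.comp β = MonoidHom.id _ := hcomp β β' a b hβσ hβ'σ hβμ hβ'μ hb
  have h2 : β.comp β' = MonoidHom.id _ :=
    hcomp β' β b a hβ'σ hβσ hβ'μ hβμ (fun m hm => by rw [mul_comm]; exact hb m hm)
  refine ⟨MonoidHom.toMulEquiv β β' h1 h2, ?_, ?_, ?_⟩
  · intro σ x y hyx; exact hβσ σ x y hyx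
  · intro x m hm hxm; exact hβμ x m hm hxm
  · intro x n hn; exact hβw x n hn

end Literature.AnabelianGeometry.AbsoluteAnabelian

end
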